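import Literature.RepresentationTheory.HeisenbergGroup.SchrodingerLeraySectionParabolic
import Literature.RepresentationTheory.HeisenbergGroup.SchrodingerLeraySectionGram
import Literature.RepresentationTheory.HeisenbergGroup.SchrodingerPiOperatorsSmooth
import Literature.RepresentationTheory.HeisenbergGroup.ImplementerSectionRigidity
import Literature.NumberTheory.Automorphic.GLnCongruenceSubgroups
import Literature.LinearAlgebra.QuadraticForm.LagrangianTransitive
import HarnessLib

/-!
# Smoothness of the Leray-normalised section on the stabiliser of its Lagrangian

Topic `RepresentationTheory/HeisenbergGroup`; namespace `Literature.RepresentationTheory.HeisenbergGroup`. KERNEL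
mathematics only (theorems; no definition, no named fact, no `axiom`, no `sorry`). Sequel of
`SchrodingerLeraySectionParabolic.lean` (values of the Schrödinger–Leray section `r` on the Siegel parabolic
`P_{ℓ_Y}`: `r(m(a) n(c)) = leviOpPi a ∘ unipOpPi c`), `SchrodingerPiOperatorsSmooth.lean` (fixed vectors of
`leviOpPi a`, `unipOpPi c` for `a` near `1`, `c` near `0`), `ImplementerSectionRigidity.lean` (`Sp`-equivariance
`r'(δ g δ⁻¹) = r(δ) r(g) r(δ)⁻¹` of Leray-normalised sections) and `SchrodingerLeraySectionGram.lean` (transport to the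
Gram duality `⟨x, T y⟩`).

**The statement** ([MoeglinVignerasWaldspurger1987] Chap. 2 II.6, II.8: the metaplectic representation restricted
to the inverse image of the parabolic `P(Y)` is the smooth representation `p ↦ r(p)` of `P(Y)` on `𝒮(X)`;
[Rangarao1993] Thm 3.5 (1)–(3), Lemma 5.1). Let `F` be a non-archimedean local field of characteristic `0`, `ψ`
a non-trivial continuous character, `W = F^ι × F^ι` with a Gram duality `β_T(x, y) = ⟨x, T y⟩` (`det T` a unit),
`ρ_T = schrodingerSB β_T ψ` the smooth Schrödinger model on `𝒮(F^ι)`, `ℓ` ANY Lagrangian of `A_T = alt (polar β_T)`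
and `r` THE normalised section of implementers of `ρ_T` whose multiplier is the Leray cocycle `c^{ψ(½·)}_ℓ`
(Rao's Theorem 4.1; tree `exists_implementerSection_cocycle_eq_lerayCentralCocycle_gram`). Then for every
`Φ ∈ 𝒮(F^ι)` there is a neighbourhood `V` of the identity in `W → W` (topology of pointwise convergence = the
product topology; on linear maps this is the topology of the matrix entries) such that
`r(g) Φ = Φ` for every `g ∈ Sp(W, A_T)` with `g ℓ = ℓ` and `⇑g ∈ V`
(`exists_nhds_forall_parabolic_apply_eq_self_gram`). In words: the homomorphism `r|_{P_ℓ} : P_ℓ → GL(𝒮(F^ι))`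
([Rangarao1993] Thm 4.1 (2)) is a SMOOTH representation of the stabiliser `P_ℓ`.

**Proof.** §1 matrices congruent to `1`: if all entries of `[a] - 1` lie in `𝔭^k` (`k ≥ 1`) then `|det a| = 1`,
the same holds for `a⁻¹` (tree `isUnit_det_and_valBound_inv`), and `a u - u ∈ (𝔭^{k+M})^ι` for `u ∈ (𝔭^M)^ι`.
§2 the standard model (`T = 1`, `ℓ = ℓ_Y = 0 ⊕ F^ι`, self-dual measure): an element `q` of `P_{ℓ_Y}` is
`m(a) n(c)` with `a = A(q)`, `c = ᵗa C(q)` (`blockA`, `blockC`), so `r(q) = leviOpPi a ∘ unipOpPi c`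
(`schrodingerLeraySection_leviSp_mul_unipotentSp`) and the boxes of `exists_box_levi_unip_eq_self` are met as soon
as the matrix entries of `A(q) - 1` and `C(q)` are deep enough — a neighbourhood of `id` in `W → W`.
§3 any Lagrangian `ℓ = δ ℓ_Y` of the standard form (`exists_isometries_map_eq`): by rigidity
(`leraySection_apply_conj`, `Sp` perfect in characteristic `0`) `r(g) = r_Y(δ) r_Y(δ⁻¹ g δ) r_Y(δ)⁻¹`, and
`f ↦ δ⁻¹ ∘ f ∘ δ` is continuous for the product topology. §4 the Gram duality `β_T`: pull back along
`e_T : (x, y) ↦ (x, T y)` (`ImplementerSection.transport`, `lerayCocycle_conj`).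

Written for GR-1's stub `L6a` (parabolic smoothness of the L0 section) of the local splitting skeleton of
[GelbartRogawski1991, Prop. 3.1.1] (stage-1 cell `pub-hodgecm`; the number-field specialisation is the sequel
`GelbartRogawski1991/LocalLeraySectionSmooth.lean`). Nothing here is a claim of the manuscripts adjudicated there.

## References

* C. Mœglin, M.-F. Vignéras, J.-L. Waldspurger, *Correspondances de Howe sur un corps p-adique*, LNM 1291 (1987),
  Chap. 2 II.6, II.8 [MoeglinVignerasWaldspurger1987].
* R. Ranga Rao, *On some explicit formulas in the theory of Weil representation*, Pacific J. Math. 157 (1993)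
  335–371: Lemma 3.2, Thm 3.5, Thm 4.1, Lemma 5.1 [Rangarao1993].
* A. Weil, *Sur certains groupes d'opérateurs unitaires*, Acta Math. 111 (1964): n° 11, n° 13 [Weil1964].
-/

set_option autoImplicit false

noncomputable section

namespace Literature.RepresentationTheory.HeisenbergGroup

open _root_.MeasureTheory Matrix Topology Filter ValuativeRel
open Literature.GroupTheory Literature.NumberTheory.Automorphic
open Literature.NumberTheory.GaloisRepresentations.IsNonarchimedeanLocalField
open Literature.NumberTheory.Weil1964 Literature.LinearAlgebra.QuadraticForm

/-! ## §1 Automorphisms of `F^ι` congruent to `1` modulo `𝔭^k` -/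

section NearOne

variable {F : Type*} [Field F] [ValuativeRel F] [TopologicalSpace F] [IsNonarchimedeanLocalField F]
  {ι : Type*} [Fintype ι] [DecidableEq ι]

omit [DecidableEq ι] in
/-- a matrix with entries in `𝔭^k` maps `(𝔭^M)^ι` into `(𝔭^{k+M})^ι`. [cite: MoeglinVignerasWaldspurger1987, Chap. 2 II.8] -/
theorem mulVec_mem_piPrimePowBall_add {k M : ℤ} {X : Matrix ι ι F} (hX : ∀ i j, X i j ∈ primePowBall F k)
    {u : ι → F} (hu : u ∈ piPrimePowBall F ι M) : X *ᵥ u ∈ piPrimePowBall F ι (k + M) :=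
  mem_piPrimePowBall_iff.2 fun i =>
    dotProduct_mem_primePowBall (x := fun j => X i j) (mem_piPrimePowBall_iff.2 fun j => hX i j) hu

/-- **`a u - u ∈ (𝔭^{k+M})^ι` for `u ∈ (𝔭^M)^ι`** when all entries of `[a] - 1` lie in `𝔭^k`.
[cite: MoeglinVignerasWaldspurger1987, Chap. 2 II.8] -/
theorem apply_sub_self_mem_piPrimePowBall {k M : ℤ} (a : (ι → F) →ₗ[F] (ι → F))
    (ha : ∀ i j, (LinearMap.toMatrix' a - 1) i j ∈ primePowBall F k) {u : ι → F} (hu : u ∈ piPrimePowBall F ι M) :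
    a u - u ∈ piPrimePowBall F ι (k + M) := by
  have h : a u - u = (LinearMap.toMatrix' a - 1) *ᵥ u := by
    rw [Matrix.sub_mulVec, LinearMap.toMatrix'_mulVec, Matrix.one_mulVec]
  rw [h]
  exact mulVec_mem_piPrimePowBall_add ha hu

/-- … hence `a` preserves every box `(𝔭^M)^ι` when `k ≥ 0`. [cite: MoeglinVignerasWaldspurger1987, Chap. 2 II.8] -/
theorem apply_mem_piPrimePowBall_of_near {k M : ℤ} (hk : 0 ≤ k) (a : (ι → F) →ₗ[F] (ι → F))
    (ha : ∀ i j, (LinearMap.toMatrix' a - 1) i j ∈ primePowBall F k) {u : ι → F} (hu : u ∈ piPrimePowBall F ι M) :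
    a u ∈ piPrimePowBall F ι M := by
  have h := add_mem_piPrimePowBall (piPrimePowBall_antitone (show M ≤ k + M by omega)
    (apply_sub_self_mem_piPrimePowBall a ha hu)) hu
  rwa [sub_add_cancel] at h

/-- `𝔭^k` (`k ≥ 1`) is a valuation ball `{v ≤ γ}` with `γ < 1`. [folklore] -/
private theorem exists_lt_one_primePowBall_eq {k : ℤ} (hk : 1 ≤ k) :
    ∃ γ : ValuativeRel.ValueGroupWithZero F, γ < 1 ∧ ∀ x : F, x ∈ primePowBall F k ↔ valuation F x ≤ γ := by
  obtain ⟨t, -, ht⟩ := exists_primePowBall_eq_setOf_valuation_le (F := F) k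
  refine ⟨valuation F t, ?_, fun x => by rw [ht]; rfl⟩
  have h1 : t ∈ primePowBall F 1 := primePowBall_antitone hk (by rw [ht, Set.mem_setOf_eq])
  have h2 : normAbs F t < 1 :=
    lt_of_le_of_lt (mem_primePowBall_iff.1 h1) (by rw [zpow_one]; exact inv_residueFieldCard_lt_one)
  exact normAbs_lt_one_iff.1 h2

omit [ValuativeRel F] [TopologicalSpace F] [IsNonarchimedeanLocalField F] in
/-- the matrix of `a⁻¹` is the inverse matrix. [folklore] -/
private theorem toMatrix'_symm_eq_inv (a : (ι → F) ≃ₗ[F] (ι → F)) :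
    LinearMap.toMatrix' (a.symm : (ι → F) →ₗ[F] (ι → F)) = (LinearMap.toMatrix' (a : (ι → F) →ₗ[F] (ι → F)))⁻¹ := by
  refine (Matrix.inv_eq_left_inv ?_).symm
  rw [← LinearMap.toMatrix'_comp]
  have : ((a.symm : (ι → F) →ₗ[F] (ι → F)) ∘ₗ (a : (ι → F) →ₗ[F] (ι → F))) = LinearMap.id := by
    apply LinearMap.ext; intro x; simp
  rw [this, LinearMap.toMatrix'_id]

/-- **if `[a] ≡ 1 (mod 𝔭^k)`, `k ≥ 1`, then `[a⁻¹] ≡ 1 (mod 𝔭^k)`** (`a⁻¹ - 1 = a⁻¹ (1 - a)` with `a⁻¹` integral).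
[cite: MoeglinVignerasWaldspurger1987, Chap. 2 II.8] -/
theorem near_symm_of_near {k : ℤ} (hk : 1 ≤ k) (a : (ι → F) ≃ₗ[F] (ι → F))
    (ha : ∀ i j, (LinearMap.toMatrix' (a : (ι → F) →ₗ[F] (ι → F)) - 1) i j ∈ primePowBall F k) :
    ∀ i j, (LinearMap.toMatrix' (a.symm : (ι → F) →ₗ[F] (ι → F)) - 1) i j ∈ primePowBall F k := by
  obtain ⟨γ, hγ, hball⟩ := exists_lt_one_primePowBall_eq (F := F) hk
  have hV : ValBound γ (LinearMap.toMatrix' (a : (ι → F) →ₗ[F] (ι → F)) - 1) := fun i j => (hball _).1 (ha i j)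
  intro i j
  rw [hball, toMatrix'_symm_eq_inv]
  exact (isUnit_det_and_valBound_inv hV hγ).2.2 i j

/-- **if `[a] ≡ 1 (mod 𝔭^k)`, `k ≥ 1`, then `|det a| = 1`**, i.e. `modSqrt a = 1`. [cite: MoeglinVignerasWaldspurger1987, Chap. 2 II.8] -/
theorem modSqrt_eq_one_of_near {k : ℤ} (hk : 1 ≤ k) (a : (ι → F) ≃ₗ[F] (ι → F))
    (ha : ∀ i j, (LinearMap.toMatrix' (a : (ι → F) →ₗ[F] (ι → F)) - 1) i j ∈ primePowBall F k) :
    modSqrt a = 1 := by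
  obtain ⟨γ, hγ, hball⟩ := exists_lt_one_primePowBall_eq (F := F) hk
  have hV : ValBound γ (LinearMap.toMatrix' (a : (ι → F) →ₗ[F] (ι → F)) - 1) := fun i j => (hball _).1 (ha i j)
  have hdet : valuation F (LinearMap.det (a : (ι → F) →ₗ[F] (ι → F))) = 1 := by
    rw [← LinearMap.det_toMatrix']
    exact valuation_det_eq_one hV hγ
  rw [modSqrt, DeltaCharBorel.normAbs_eq_one_of_valuation_eq_one hdet, NNReal.coe_one, Real.sqrt_one]

omit [ValuativeRel F] [TopologicalSpace F] [IsNonarchimedeanLocalField F] in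
/-- the `(i, j)` entry of `[a] - 1` is the `i`-th coordinate of `a e_j - e_j`. [folklore] -/
private theorem toMatrix'_sub_one_apply (a : (ι → F) →ₗ[F] (ι → F)) (i j : ι) :
    (LinearMap.toMatrix' a - 1) i j = (a (Pi.single j 1) - (Pi.single j 1 : ι → F)) i := by
  rw [Matrix.sub_apply, LinearMap.toMatrix'_apply, Pi.sub_apply, Matrix.one_apply, Pi.single_apply]

/-- `c u ∈ (𝔭^{k+M})^ι` for `u ∈ (𝔭^M)^ι` when all entries of `[c]` lie in `𝔭^k`. [cite: MoeglinVignerasWaldspurger1987, Chap. 2 II.8] -/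
theorem apply_mem_piPrimePowBall_add {k M : ℤ} (c : (ι → F) →ₗ[F] (ι → F))
    (hc : ∀ i j, LinearMap.toMatrix' c i j ∈ primePowBall F k) {u : ι → F} (hu : u ∈ piPrimePowBall F ι M) :
    c u ∈ piPrimePowBall F ι (k + M) := by
  rw [← LinearMap.toMatrix'_mulVec c u]
  exact mulVec_mem_piPrimePowBall_add hc hu

end NearOne

/-! ## §2 The Schrödinger–Leray section on `P_{ℓ_Y}`: `q = m(a) n(c)` and smoothness -/

section PiY

variable {F : Type*} [Field F] [ValuativeRel F] [TopologicalSpace F] [IsNonarchimedeanLocalField F]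
  {ι : Type*} [Fintype ι] [DecidableEq ι] [Invertible (2 : F)]
  {ψ : AddChar F Circle} (hl : IsLocallyConstant (⇑ψ : F → Circle))
  (hb : ∀ y : ι → F, Continuous fun u : ι → F => dotProductBilin F F u y)
  [MeasurableSpace F] [BorelSpace F] (μ : Measure F) [μ.IsAddHaarMeasure] {m : ℤ}


omit [ValuativeRel F] [TopologicalSpace F] [IsNonarchimedeanLocalField F] [DecidableEq ι] [Invertible (2 : F)]
  [MeasurableSpace F] [BorelSpace F] in
/-- the `B`-block of an element of `P_{ℓ_Y}` vanishes: `(q(0, y))₁ = 0`. [cite: Rangarao1993, §2.2 (2.6), p. 341] -/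
theorem blockB_eq_zero_of_map_prod_bot_top (q : (symplecticGroup (polar (dotProductBilin F F (m := ι)))))
    (hq : Submodule.map ((q : ((ι → F) × (ι → F)) ≃ₗ[F] ((ι → F) × (ι → F))) : ((ι → F) × (ι → F)) →ₗ[F] ((ι → F) × (ι → F))) (Submodule.prod (⊥ : Submodule F (ι → F)) (⊤ : Submodule F (ι → F))) = (Submodule.prod (⊥ : Submodule F (ι → F)) (⊤ : Submodule F (ι → F)))) (y : ι → F) : blockB (q : ((ι → F) × (ι → F)) ≃ₗ[F] ((ι → F) × (ι → F))) y = 0 := by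
  have h : (q : ((ι → F) × (ι → F)) ≃ₗ[F] ((ι → F) × (ι → F))) (0, y) ∈ Submodule.map ((q : ((ι → F) × (ι → F)) ≃ₗ[F] ((ι → F) × (ι → F))) : ((ι → F) × (ι → F)) →ₗ[F] ((ι → F) × (ι → F))) (Submodule.prod (⊥ : Submodule F (ι → F)) (⊤ : Submodule F (ι → F))) :=
    Submodule.mem_map_of_mem ((mem_prod_bot_top_iff _).2 rfl)
  rw [hq, mem_prod_bot_top_iff] at h
  exact h

omit [ValuativeRel F] [TopologicalSpace F] [IsNonarchimedeanLocalField F] [DecidableEq ι] [Invertible (2 : F)]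
  [MeasurableSpace F] [BorelSpace F] in
/-- for `q ∈ P_{ℓ_Y}`: `⟨A x, D y⟩ = ⟨x, y⟩` (`ᵗA D = 1`). [cite: Rangarao1993, §2.2 (2.6), p. 341; Weil1964, n° 3 (4), p. 148] -/
theorem blockA_dotProduct_blockD_of_map_prod_bot_top (q : (symplecticGroup (polar (dotProductBilin F F (m := ι)))))
    (hq : Submodule.map ((q : ((ι → F) × (ι → F)) ≃ₗ[F] ((ι → F) × (ι → F))) : ((ι → F) × (ι → F)) →ₗ[F] ((ι → F) × (ι → F))) (Submodule.prod (⊥ : Submodule F (ι → F)) (⊤ : Submodule F (ι → F))) = (Submodule.prod (⊥ : Submodule F (ι → F)) (⊤ : Submodule F (ι → F)))) (x y : ι → F) :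
    blockA (q : ((ι → F) × (ι → F)) ≃ₗ[F] ((ι → F) × (ι → F))) x ⬝ᵥ blockD (q : ((ι → F) × (ι → F)) ≃ₗ[F] ((ι → F) × (ι → F))) y = x ⬝ᵥ y := by
  have h := blockA_dotProduct_blockD_sub q x y
  rwa [blockB_eq_zero_of_map_prod_bot_top q hq, zero_dotProduct, sub_zero] at h

omit [ValuativeRel F] [TopologicalSpace F] [IsNonarchimedeanLocalField F] [Invertible (2 : F)]
  [MeasurableSpace F] [BorelSpace F] in
/-- for `q ∈ P_{ℓ_Y}` the `A`-block is injective (hence an automorphism of `F^ι`). [cite: Rangarao1993, §2.2 (2.6), p. 341] -/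
theorem blockA_injective_of_map_prod_bot_top (q : (symplecticGroup (polar (dotProductBilin F F (m := ι)))))
    (hq : Submodule.map ((q : ((ι → F) × (ι → F)) ≃ₗ[F] ((ι → F) × (ι → F))) : ((ι → F) × (ι → F)) →ₗ[F] ((ι → F) × (ι → F))) (Submodule.prod (⊥ : Submodule F (ι → F)) (⊤ : Submodule F (ι → F))) = (Submodule.prod (⊥ : Submodule F (ι → F)) (⊤ : Submodule F (ι → F)))) : Function.Injective (blockA (q : ((ι → F) × (ι → F)) ≃ₗ[F] ((ι → F) × (ι → F)))) := by
  refine (injective_iff_map_eq_zero _).2 fun x hx => funext fun i => ?_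
  have h := blockA_dotProduct_blockD_of_map_prod_bot_top q hq x (Pi.single i 1)
  rw [hx, zero_dotProduct, dotProduct_single, mul_one] at h
  exact h.symm

omit [ValuativeRel F] [TopologicalSpace F] [IsNonarchimedeanLocalField F] [MeasurableSpace F] [BorelSpace F] in
/-- **an element of the Siegel parabolic `P_{ℓ_Y}` is `m(a) n(c)`** with `a = A(q)` (the action on `W/ℓ_Y ≅ X`),
`D(q) = ᵗa⁻¹` and `c = ᵗa C(q)` symmetric. [cite: Rangarao1993, §2.2 (2.6)–(2.7), p. 341; Weil1964, n° 6–7, pp. 151–152] -/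
theorem exists_eq_leviSp_mul_unipotentSp (q : (symplecticGroup (polar (dotProductBilin F F (m := ι)))))
    (hq : Submodule.map ((q : ((ι → F) × (ι → F)) ≃ₗ[F] ((ι → F) × (ι → F))) : ((ι → F) × (ι → F)) →ₗ[F] ((ι → F) × (ι → F))) (Submodule.prod (⊥ : Submodule F (ι → F)) (⊤ : Submodule F (ι → F))) = (Submodule.prod (⊥ : Submodule F (ι → F)) (⊤ : Submodule F (ι → F)))) :
    ∃ (a : (ι → F) ≃ₗ[F] (ι → F)) (c : (ι → F) →ₗ[F] (ι → F))
      (hc : ∀ x x' : ι → F, dotProductBilin F F x (c x') = dotProductBilin F F x' (c x)),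
      (∀ x, a x = blockA (q : ((ι → F) × (ι → F)) ≃ₗ[F] ((ι → F) × (ι → F))) x) ∧
        (∀ x, c x = transposePi a (blockC (q : ((ι → F) × (ι → F)) ≃ₗ[F] ((ι → F) × (ι → F))) x)) ∧ q = leviSp (dotProductBilin F F (m := ι)) a (dualLeviPi a) (dotProductBilin_apply_dualLeviPi a) * unipotentSp (dotProductBilin F F (m := ι)) c hc := by
  set a : (ι → F) ≃ₗ[F] (ι → F) :=
    LinearEquiv.ofInjectiveEndo (blockA (q : ((ι → F) × (ι → F)) ≃ₗ[F] ((ι → F) × (ι → F)))) (blockA_injective_of_map_prod_bot_top q hq) with ha_def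
  have ha : ∀ x, a x = blockA (q : ((ι → F) × (ι → F)) ≃ₗ[F] ((ι → F) × (ι → F))) x := fun x => rfl
  -- `D = ᵗa⁻¹`
  have hD : ∀ y, blockD (q : ((ι → F) × (ι → F)) ≃ₗ[F] ((ι → F) × (ι → F))) y = dualLeviPi a y := by
    intro y
    have key : ∀ x, a x ⬝ᵥ blockD (q : ((ι → F) × (ι → F)) ≃ₗ[F] ((ι → F) × (ι → F))) y = a x ⬝ᵥ dualLeviPi a y := fun x => by
      rw [ha, blockA_dotProduct_blockD_of_map_prod_bot_top q hq, ← ha, dotProduct_dualLeviPi,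
        LinearEquiv.symm_apply_apply]
    funext i
    have h := key (a.symm (Pi.single i 1))
    rwa [LinearEquiv.apply_symm_apply, single_dotProduct, single_dotProduct, one_mul, one_mul] at h
  -- `c = ᵗa C`, symmetric since `ᵗA C = ᵗC A`
  set c : (ι → F) →ₗ[F] (ι → F) := (transposePi a : (ι → F) →ₗ[F] (ι → F)) ∘ₗ blockC (q : ((ι → F) × (ι → F)) ≃ₗ[F] ((ι → F) × (ι → F))) with hc_def
  have hca : ∀ x, c x = transposePi a (blockC (q : ((ι → F) × (ι → F)) ≃ₗ[F] ((ι → F) × (ι → F))) x) := fun x => rfl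
  have hc : ∀ x x' : ι → F, dotProductBilin F F x (c x') = dotProductBilin F F x' (c x) := fun x x' => by
    rw [hca, hca, dotProductBilin_transposePi, dotProductBilin_transposePi, ha, ha, dotProductBilin_apply_apply,
      dotProductBilin_apply_apply]
    exact blockA_dotProduct_blockC q x x'
  refine ⟨a, c, hc, ha, hca, Subtype.ext (LinearEquiv.ext fun v => ?_)⟩
  obtain ⟨x, y⟩ := v
  rw [apply_eq_blocks, blockB_eq_zero_of_map_prod_bot_top q hq, add_zero, hD, Subgroup.coe_mul,
    LinearEquiv.mul_apply, coe_unipotentSp, unipotentσ_apply, coe_leviSp_apply, map_add, hca,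
    dualLeviPi_transposePi_apply, ha, add_comm (blockC _ x)]

/-- **SMOOTHNESS OF THE SCHRÖDINGER–LERAY SECTION ON `P_{ℓ_Y}`**: for every `Ψ ∈ 𝒮(F^ι)` there is a
neighbourhood `V` of `id` in `W → W` (product topology) such that `r(q) Ψ = Ψ` for all `q ∈ P_{ℓ_Y}` with `⇑q ∈ V`
— `r(q) = leviOpPi A(q) ∘ unipOpPi (ᵗA(q) C(q))` and both operators fix `Ψ` once the entries of `A(q) - 1` and
`C(q)` are deep enough. [cite: MoeglinVignerasWaldspurger1987, Chap. 2 II.6, II.8; Rangarao1993, Lemma 3.2, Thm 3.5 (3)] -/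
theorem schrodingerLeraySection_exists_nhds_parabolic (hψ : ψ.IsContinuousNontrivial) (hm : ψ.HasConductorExp m)
    (hμ : IsSelfDualMeasure ψ μ) (Ψ : SchwartzBruhat (ι → F)) :
    ∃ V ∈ 𝓝 (id : ((ι → F) × (ι → F)) → ((ι → F) × (ι → F))), ∀ q : (symplecticGroup (polar (dotProductBilin F F (m := ι)))), Submodule.map ((q : ((ι → F) × (ι → F)) ≃ₗ[F] ((ι → F) × (ι → F))) : ((ι → F) × (ι → F)) →ₗ[F] ((ι → F) × (ι → F))) (Submodule.prod (⊥ : Submodule F (ι → F)) (⊤ : Submodule F (ι → F))) = (Submodule.prod (⊥ : Submodule F (ι → F)) (⊤ : Submodule F (ι → F))) →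
      (⇑(q : ((ι → F) × (ι → F)) ≃ₗ[F] ((ι → F) × (ι → F))) : ((ι → F) × (ι → F)) → ((ι → F) × (ι → F))) ∈ V → schrodingerLeraySection hl μ hψ hm hμ q Ψ = Ψ := by
  obtain ⟨M, N, hlevi, hunip⟩ := exists_box_levi_unip_eq_self hl hm Ψ
  obtain ⟨t, ht⟩ := exists_mem_primePowBall (⅟(2 : F))
  -- depths of the congruences on `A(q) - 1` and on `C(q)`
  obtain ⟨k, hk1, hkN⟩ : ∃ k : ℤ, 1 ≤ k ∧ N ≤ k + M := ⟨max 1 (N - M), le_max_left _ _, by omega⟩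
  obtain ⟨k', hk'⟩ : ∃ k' : ℤ, m ≤ t + (M + (k' + M)) := ⟨m - t - M - M, by omega⟩
  have hk0 : (0 : ℤ) ≤ k := by omega
  -- the neighbourhood: entries of `A - 1` in `𝔭^k`, entries of `C` in `𝔭^k'`
  have hev : ∀ v : ((ι → F) × (ι → F)), Continuous fun f : ((ι → F) × (ι → F)) → ((ι → F) × (ι → F)) => f v := fun v => continuous_apply v
  have hcA : ∀ i j : ι, Continuous fun f : ((ι → F) × (ι → F)) → ((ι → F) × (ι → F)) => ((f (Pi.single j 1, 0)).1 - (Pi.single j 1 : ι → F)) i :=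
    fun i j => (continuous_apply i).comp ((continuous_fst.comp (hev (Pi.single j 1, 0))).sub continuous_const)
  have hcC : ∀ i j : ι, Continuous fun f : ((ι → F) × (ι → F)) → ((ι → F) × (ι → F)) => (f (Pi.single j 1, 0)).2 i :=
    fun i j => (continuous_apply i).comp (continuous_snd.comp (hev (Pi.single j 1, 0)))
  refine ⟨⋂ i : ι, ⋂ j : ι,
      ((fun f : ((ι → F) × (ι → F)) → ((ι → F) × (ι → F)) => ((f (Pi.single j 1, 0)).1 - (Pi.single j 1 : ι → F)) i) ⁻¹' primePowBall F k ∩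
        (fun f : ((ι → F) × (ι → F)) → ((ι → F) × (ι → F)) => (f (Pi.single j 1, 0)).2 i) ⁻¹' primePowBall F k'), ?_, fun q hq hqV => ?_⟩
  · refine IsOpen.mem_nhds ?_ ?_
    · exact isOpen_iInter_of_finite fun i => isOpen_iInter_of_finite fun j =>
        ((isOpen_primePowBall k).preimage (hcA i j)).inter ((isOpen_primePowBall k').preimage (hcC i j))
    · refine Set.mem_iInter.2 fun i => Set.mem_iInter.2 fun j => ⟨?_, ?_⟩
      · show ((id (Pi.single j 1, (0 : ι → F)) : ((ι → F) × (ι → F))).1 - (Pi.single j 1 : ι → F)) i ∈ primePowBall F k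
        rw [id, sub_self]
        exact zero_mem_primePowBall k
      · show ((id (Pi.single j 1, (0 : ι → F)) : ((ι → F) × (ι → F)))).2 i ∈ primePowBall F k'
        exact zero_mem_primePowBall k'
  · have hqV' : ∀ i j : ι, (((q : ((ι → F) × (ι → F)) ≃ₗ[F] ((ι → F) × (ι → F))) (Pi.single j 1, 0)).1 - (Pi.single j 1 : ι → F)) i ∈ primePowBall F k ∧
        ((q : ((ι → F) × (ι → F)) ≃ₗ[F] ((ι → F) × (ι → F))) (Pi.single j 1, 0)).2 i ∈ primePowBall F k' := fun i j =>
      Set.mem_iInter.1 (Set.mem_iInter.1 hqV i) j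
    obtain ⟨a, c, hc, ha, hca, hq'⟩ := exists_eq_leviSp_mul_unipotentSp q hq
    have hA : ∀ i j, (LinearMap.toMatrix' (a : (ι → F) →ₗ[F] (ι → F)) - 1) i j ∈ primePowBall F k := fun i j => by
      rw [toMatrix'_sub_one_apply, LinearEquiv.coe_coe, ha, blockA_apply]
      exact (hqV' i j).1
    have hC : ∀ i j, LinearMap.toMatrix' (blockC (q : ((ι → F) × (ι → F)) ≃ₗ[F] ((ι → F) × (ι → F)))) i j ∈ primePowBall F k' := fun i j => by
      rw [LinearMap.toMatrix'_apply, blockC_apply]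
      exact (hqV' i j).2
    have hA' := near_symm_of_near hk1 a hA
    have ha_box : ∀ u ∈ piPrimePowBall F ι M, a u ∈ piPrimePowBall F ι M := fun u hu => by
      have h := apply_mem_piPrimePowBall_of_near hk0 (a : (ι → F) →ₗ[F] (ι → F)) hA hu
      rwa [LinearEquiv.coe_coe] at h
    have hbox : ∀ u, a.symm u ∈ piPrimePowBall F ι M ↔ u ∈ piPrimePowBall F ι M := fun u =>
      ⟨fun hu => by
        have h := ha_box _ hu
        rwa [LinearEquiv.apply_symm_apply] at h,
       fun hu => by
        have h := apply_mem_piPrimePowBall_of_near hk0 (a.symm : (ι → F) →ₗ[F] (ι → F)) hA' hu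
        rwa [LinearEquiv.coe_coe] at h⟩
    have hnear : ∀ u ∈ piPrimePowBall F ι M, a.symm u - u ∈ piPrimePowBall F ι N := fun u hu => by
      have h := apply_sub_self_mem_piPrimePowBall (a.symm : (ι → F) →ₗ[F] (ι → F)) hA' hu
      rw [LinearEquiv.coe_coe] at h
      exact piPrimePowBall_antitone hkN h
    -- `½⟨u, c u⟩ = ½⟨a u, C u⟩ ∈ 𝔭^{t + M + k' + M} ⊆ 𝔭^m`
    have hhalf : ∀ u ∈ piPrimePowBall F ι M, halfForm c u ∈ primePowBall F m := fun u hu => by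
      rw [halfForm_apply, hca, dotProduct_transposePi]
      exact primePowBall_antitone hk' (mul_mem_primePowBall ht
        (dotProduct_mem_primePowBall (ha_box u hu) (apply_mem_piPrimePowBall_add _ hC hu)))
    rw [hq', schrodingerLeraySection_leviSp_mul_unipotentSp hl μ hψ hm hμ a c hc, LinearEquiv.mul_apply,
      hunip c hhalf, hlevi a (modSqrt_eq_one_of_near hk1 a hA) hbox hnear]

/-! ## §3 Conjugating neighbourhoods of `id` in `W → W`; any Lagrangian of the standard form -/

omit [ValuativeRel F] [IsNonarchimedeanLocalField F] [DecidableEq ι] [Invertible (2 : F)] [MeasurableSpace F]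
  [BorelSpace F] in
/-- every linear endomorphism of `W = F^ι × F^ι` is continuous (product topology). [folklore] -/
private theorem continuous_linearMap_prod_pi [IsTopologicalRing F] (f : ((ι → F) × (ι → F)) →ₗ[F] ((ι → F) × (ι → F))) : Continuous f := by
  have h : (⇑f : ((ι → F) × (ι → F)) → ((ι → F) × (ι → F))) = fun p =>
      (f ∘ₗ LinearMap.inl F (ι → F) (ι → F)) p.1 + (f ∘ₗ LinearMap.inr F (ι → F) (ι → F)) p.2 := by
    funext p
    rw [LinearMap.comp_apply, LinearMap.comp_apply, LinearMap.inl_apply, LinearMap.inr_apply, ← map_add,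
      Prod.mk_add_mk, add_zero, zero_add]
  rw [h]
  exact ((f ∘ₗ LinearMap.inl F (ι → F) (ι → F)).continuous_on_pi.comp continuous_fst).add
    ((f ∘ₗ LinearMap.inr F (ι → F) (ι → F)).continuous_on_pi.comp continuous_snd)

omit [ValuativeRel F] [IsNonarchimedeanLocalField F] [DecidableEq ι] [Invertible (2 : F)] [MeasurableSpace F]
  [BorelSpace F] in
/-- **conjugation `f ↦ φ ∘ f ∘ χ` pulls neighbourhoods of `id` back to neighbourhoods of `id`** (`φ χ = id`, `φ`
linear): the product topology on `W → W` is compatible with a linear change of coordinates. [folklore] -/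
private theorem conj_preimage_mem_nhds_id [IsTopologicalRing F] (φ χ : ((ι → F) × (ι → F)) →ₗ[F] ((ι → F) × (ι → F))) (hφχ : ∀ v, φ (χ v) = v)
    {V : Set (((ι → F) × (ι → F)) → ((ι → F) × (ι → F)))} (hV : V ∈ 𝓝 (id : ((ι → F) × (ι → F)) → ((ι → F) × (ι → F)))) :
    (fun f : ((ι → F) × (ι → F)) → ((ι → F) × (ι → F)) => (⇑φ) ∘ f ∘ (⇑χ)) ⁻¹' V ∈ 𝓝 (id : ((ι → F) × (ι → F)) → ((ι → F) × (ι → F))) := by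
  have hc : Continuous fun f : ((ι → F) × (ι → F)) → ((ι → F) × (ι → F)) => (⇑φ) ∘ f ∘ (⇑χ) :=
    continuous_pi fun w => (continuous_linearMap_prod_pi φ).comp (continuous_apply (χ w))
  refine hc.continuousAt.preimage_mem_nhds ?_
  have hid : (⇑φ) ∘ (id : ((ι → F) × (ι → F)) → ((ι → F) × (ι → F))) ∘ (⇑χ) = id := funext fun v => hφχ v
  rwa [hid]

variable [CharZero F]

/-- **SMOOTHNESS OF A LERAY-NORMALISED SECTION ON THE STABILISER OF ITS LAGRANGIAN (standard duality, any
Lagrangian `ℓ`)**: if `r` is a normalised section of implementers of `ρ = schrodingerSB ⟨·,·⟩ ψ` on `𝒮(F^ι)` whose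
cocycle is the Leray cocycle `c^{ψ(½·)}_ℓ` then for every `Φ` there is a neighbourhood `V` of `id` in `W → W` with
`r(g) Φ = Φ` for all `g ∈ Sp` with `gℓ = ℓ`, `⇑g ∈ V`.  Proof: `ℓ = δ ℓ_Y` (`exists_isometries_map_eq`); by the
`Sp`-equivariance of Leray sections (`leraySection_apply_conj`, rigidity, `Sp` perfect) `r(δ q δ⁻¹) =
r_Y(δ) r_Y(q) r_Y(δ)⁻¹` with `r_Y` the Schrödinger–Leray section; §2 at `Ψ = r_Y(δ)⁻¹ Φ`.
[cite: MoeglinVignerasWaldspurger1987, Chap. 2 II.6, II.8; Rangarao1993, Thm 3.5 (2), Lemma 5.1] -/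
theorem exists_nhds_forall_parabolic_apply_eq_self_pi (hψ : ψ.IsContinuousNontrivial)
    (hU : ImplementerUniqueUpToScalar (schrodingerSB (dotProductBilin F F (m := ι)) ψ hl hb))
    (r : ImplementerSection (schrodingerSB (dotProductBilin F F (m := ι)) ψ hl hb))
    {ℓ : Submodule F ((ι → F) × (ι → F))} (hℓ : LinearMap.BilinForm.orthogonal (alt (polar (dotProductBilin F F (m := ι)))) ℓ = ℓ)
    (hr : r.cocycle hU = lerayCentralCocycle μ (isContinuousNontrivial_mulShift_half hψ)
      (isAlt_alt_polar_dotProductBilin (F := F) (ι := ι)) nondegenerate_alt_polar_dotProductBilin hℓ)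
    (Φ : SchwartzBruhat (ι → F)) :
    ∃ V ∈ 𝓝 (id : ((ι → F) × (ι → F)) → ((ι → F) × (ι → F))), ∀ g : (symplecticGroup (polar (dotProductBilin F F (m := ι)))), Submodule.map ((g : ((ι → F) × (ι → F)) ≃ₗ[F] ((ι → F) × (ι → F))) : ((ι → F) × (ι → F)) →ₗ[F] ((ι → F) × (ι → F))) ℓ = ℓ →
      (⇑(g : ((ι → F) × (ι → F)) ≃ₗ[F] ((ι → F) × (ι → F))) : ((ι → F) × (ι → F)) → ((ι → F) × (ι → F))) ∈ V → r g Φ = Φ := by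
  have hA := isAlt_alt_polar_dotProductBilin (F := F) (ι := ι)
  have hN := nondegenerate_alt_polar_dotProductBilin (F := F) (ι := ι)
  have hψ' := isContinuousNontrivial_mulShift_half (F := F) hψ
  -- `ℓ = δ ℓ_Y`
  obtain ⟨δ, hδ⟩ : ∃ δ : (symplecticGroup (polar (dotProductBilin F F (m := ι)))), Submodule.map ((δ : ((ι → F) × (ι → F)) ≃ₗ[F] ((ι → F) × (ι → F))) : ((ι → F) × (ι → F)) →ₗ[F] ((ι → F) × (ι → F))) (Submodule.prod (⊥ : Submodule F (ι → F)) (⊤ : Submodule F (ι → F))) = ℓ :=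
    exists_isometries_map_eq hA hN (orthogonal_prod_bot_top (F := F) (ι := ι)) hℓ
  subst hδ
  -- the Schrödinger–Leray section `r_Y` (self-dual measure, conductor exponent)
  obtain ⟨m₀, hm₀⟩ := hψ.exists_hasConductorExp
  obtain ⟨μ₀, hμ₀, hsd⟩ := exists_isSelfDualMeasure hψ
  haveI := hμ₀
  have hY : (schrodingerLerayImplementerSection hl hb μ₀ hψ hm₀ hsd).cocycle hU =
      lerayCentralCocycle μ₀ hψ' hA hN orthogonal_prod_bot_top := by
    have h := schrodingerCocyclePi_eq_lerayCentralCocycle hl hb μ₀ hψ hm₀ hsd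
    rw [schrodingerCocyclePi_def] at h
    exact h
  -- `c_r = c_{δ ℓ_Y}` also for the measure `μ₀`
  have hr' : r.cocycle hU = lerayCentralCocycle μ₀ hψ' hA hN (orthogonal_map_symplectic_eq_self hN
      (orthogonal_prod_bot_top (F := F) (ι := ι)) δ) := by
    rw [hr]
    refine CentralCocycle.ext fun g g' => Units.ext ?_
    rw [lerayCentralCocycle_apply, lerayCentralCocycle_apply]
    exact lerayCocycle_eq_of_isAddHaarMeasure μ₀ μ hψ' _ _ _ _
  -- `Sp`-equivariance: `r(δ q δ⁻¹) = r_Y(δ) r_Y(q) r_Y(δ)⁻¹`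
  have hconj := leraySection_apply_conj μ₀ monoidHom_symplecticGroup_pi_eq_one hψ' hA hN orthogonal_prod_bot_top δ hU
    (schrodingerLerayImplementerSection hl hb μ₀ hψ hm₀ hsd) r hY hr'
  -- §2 at `Ψ = r_Y(δ)⁻¹ Φ`, pulled back along `f ↦ δ⁻¹ ∘ f ∘ δ`
  obtain ⟨VY, hVY, hfix⟩ := schrodingerLeraySection_exists_nhds_parabolic hl μ₀ hψ hm₀ hsd
    ((schrodingerLerayImplementerSection hl hb μ₀ hψ hm₀ hsd δ).symm Φ)
  refine ⟨(fun f : ((ι → F) × (ι → F)) → ((ι → F) × (ι → F)) => (⇑((δ : ((ι → F) × (ι → F)) ≃ₗ[F] ((ι → F) × (ι → F))).symm : ((ι → F) × (ι → F)) →ₗ[F] ((ι → F) × (ι → F)))) ∘ f ∘ (⇑((δ : ((ι → F) × (ι → F)) ≃ₗ[F] ((ι → F) × (ι → F))) : ((ι → F) × (ι → F)) →ₗ[F] ((ι → F) × (ι → F))))) ⁻¹' VY,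
    conj_preimage_mem_nhds_id _ _ (fun v => (δ : ((ι → F) × (ι → F)) ≃ₗ[F] ((ι → F) × (ι → F))).symm_apply_apply v) hVY, fun g hg hgV => ?_⟩
  -- `q = δ⁻¹ g δ ∈ P_{ℓ_Y}` with `⇑q ∈ VY`
  set q : (symplecticGroup (polar (dotProductBilin F F (m := ι)))) := δ⁻¹ * g * δ with hq_def
  have hgq : g = δ * q * δ⁻¹ := by rw [hq_def]; group
  have hcoe : (⇑(q : ((ι → F) × (ι → F)) ≃ₗ[F] ((ι → F) × (ι → F))) : ((ι → F) × (ι → F)) → ((ι → F) × (ι → F))) =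
      (⇑((δ : ((ι → F) × (ι → F)) ≃ₗ[F] ((ι → F) × (ι → F))).symm : ((ι → F) × (ι → F)) →ₗ[F] ((ι → F) × (ι → F)))) ∘ (⇑(g : ((ι → F) × (ι → F)) ≃ₗ[F] ((ι → F) × (ι → F)))) ∘ (⇑((δ : ((ι → F) × (ι → F)) ≃ₗ[F] ((ι → F) × (ι → F))) : ((ι → F) × (ι → F)) →ₗ[F] ((ι → F) × (ι → F)))) := by
    funext v
    simp only [hq_def, Subgroup.coe_mul, Subgroup.coe_inv, LinearEquiv.mul_apply, LinearEquiv.coe_inv,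
      Function.comp_apply, LinearEquiv.coe_coe]
  have hq : Submodule.map ((q : ((ι → F) × (ι → F)) ≃ₗ[F] ((ι → F) × (ι → F))) : ((ι → F) × (ι → F)) →ₗ[F] ((ι → F) × (ι → F))) (Submodule.prod (⊥ : Submodule F (ι → F)) (⊤ : Submodule F (ι → F))) = (Submodule.prod (⊥ : Submodule F (ι → F)) (⊤ : Submodule F (ι → F))) := by
    have e1 : ((q : ((ι → F) × (ι → F)) ≃ₗ[F] ((ι → F) × (ι → F))) : ((ι → F) × (ι → F)) →ₗ[F] ((ι → F) × (ι → F))) =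
        ((δ : ((ι → F) × (ι → F)) ≃ₗ[F] ((ι → F) × (ι → F))).symm : ((ι → F) × (ι → F)) →ₗ[F] ((ι → F) × (ι → F))) ∘ₗ ((g : ((ι → F) × (ι → F)) ≃ₗ[F] ((ι → F) × (ι → F))) : ((ι → F) × (ι → F)) →ₗ[F] ((ι → F) × (ι → F))) ∘ₗ ((δ : ((ι → F) × (ι → F)) ≃ₗ[F] ((ι → F) × (ι → F))) : ((ι → F) × (ι → F)) →ₗ[F] ((ι → F) × (ι → F))) :=
      LinearMap.ext fun v => congrFun hcoe v
    have e2 : ((δ : ((ι → F) × (ι → F)) ≃ₗ[F] ((ι → F) × (ι → F))).symm : ((ι → F) × (ι → F)) →ₗ[F] ((ι → F) × (ι → F))) ∘ₗ ((δ : ((ι → F) × (ι → F)) ≃ₗ[F] ((ι → F) × (ι → F))) : ((ι → F) × (ι → F)) →ₗ[F] ((ι → F) × (ι → F))) = LinearMap.id :=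
      LinearMap.ext fun v => (δ : ((ι → F) × (ι → F)) ≃ₗ[F] ((ι → F) × (ι → F))).symm_apply_apply v
    rw [e1, Submodule.map_comp, Submodule.map_comp, hg, ← Submodule.map_comp, e2, Submodule.map_id]
  have hqV : (⇑(q : ((ι → F) × (ι → F)) ≃ₗ[F] ((ι → F) × (ι → F))) : ((ι → F) × (ι → F)) → ((ι → F) × (ι → F))) ∈ VY := by rw [hcoe]; exact hgV
  rw [hgq, hconj, LinearEquiv.mul_apply, LinearEquiv.mul_apply, LinearEquiv.coe_inv,
    schrodingerLerayImplementerSection_apply _ _ _ _ _ _ q, hfix q hq hqV, LinearEquiv.apply_symm_apply]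

end PiY

/-! ## §4 The Gram duality `β_T(x, y) = ⟨x, T y⟩` -/

section Gram

variable {F : Type*} [Field F] [ValuativeRel F] [TopologicalSpace F] [IsNonarchimedeanLocalField F] [CharZero F]
  {ι : Type*} [Fintype ι] [DecidableEq ι] [Invertible (2 : F)] (T : Matrix ι ι F) (hT : IsUnit T.det)
  {ψ : AddChar F Circle} (hl : IsLocallyConstant (⇑ψ : F → Circle))
  (hbT : ∀ y : ι → F, Continuous fun u : ι → F => Matrix.toLinearMap₂' F T u y)
  [MeasurableSpace F] [BorelSpace F] (μ : Measure F) [μ.IsAddHaarMeasure]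


/-- **SMOOTHNESS OF THE LERAY-NORMALISED SECTION ON THE STABILISER OF ITS LAGRANGIAN** for the Schrödinger model
`ρ_T = schrodingerSB β_T ψ` of a Gram duality (`det T` a unit) and ANY Lagrangian `ℓ` of `A_T`: if the cocycle of
the normalised section `r` is the Leray cocycle `c^{ψ(½·)}_ℓ` (Rao's Theorem 4.1 (5)), then for every `Φ ∈ 𝒮(F^ι)`
there is a neighbourhood `V` of `id` in `W → W` (product topology) with `r(g) Φ = Φ` for all `g ∈ Sp(W, A_T)`,
`gℓ = ℓ`, `⇑g ∈ V` — the representation `r|_{P_ℓ}` of the stabiliser `P_ℓ` is smooth.  Pull-back of §3 along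
`e_T : (x, y) ↦ (x, T y)`. [cite: MoeglinVignerasWaldspurger1987, Chap. 2 II.6, II.8; Rangarao1993, Thm 3.5, Thm 4.1, Lemma 5.1] -/
theorem exists_nhds_forall_parabolic_apply_eq_self_gram (hψ : ψ.IsContinuousNontrivial)
    (hU : ImplementerUniqueUpToScalar (schrodingerSB (Matrix.toLinearMap₂' F T) ψ hl hbT))
    (r : ImplementerSection (schrodingerSB (Matrix.toLinearMap₂' F T) ψ hl hbT))
    {ℓ : Submodule F ((ι → F) × (ι → F))} (hℓ : LinearMap.BilinForm.orthogonal (alt (polar (Matrix.toLinearMap₂' F T))) ℓ = ℓ)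
    (hr : r.cocycle hU = lerayCentralCocycle μ (isContinuousNontrivial_mulShift_half hψ) (isAlt_alt_polar_gram T)
      (nondegenerate_alt_polar_gram T hT) hℓ)
    (Φ : SchwartzBruhat (ι → F)) :
    ∃ V ∈ 𝓝 (id : ((ι → F) × (ι → F)) → ((ι → F) × (ι → F))), ∀ g : (symplecticGroup (polar (Matrix.toLinearMap₂' F T))), Submodule.map ((g : ((ι → F) × (ι → F)) ≃ₗ[F] ((ι → F) × (ι → F))) : ((ι → F) × (ι → F)) →ₗ[F] ((ι → F) × (ι → F))) ℓ = ℓ →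
      (⇑(g : ((ι → F) × (ι → F)) ≃ₗ[F] ((ι → F) × (ι → F))) : ((ι → F) × (ι → F)) → ((ι → F) × (ι → F))) ∈ V → r g Φ = Φ := by
  have hψ' := isContinuousNontrivial_mulShift_half (F := F) hψ
  set e := gramProd T hT with he_def
  have hpol := polar_dotProductBilin_gramProd T hT
  have hA : ∀ v w : ((ι → F) × (ι → F)), (alt (polar (dotProductBilin F F (m := ι)))) (e v) (e w) = (alt (polar (Matrix.toLinearMap₂' F T))) v w := alt_polar_dotProductBilin_gramProd T hT
  have hA' : ∀ v w : ((ι → F) × (ι → F)), (alt (polar (Matrix.toLinearMap₂' F T))) (e.symm v) (e.symm w) = (alt (polar (dotProductBilin F F (m := ι)))) v w := fun v w => by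
    rw [← hA, LinearEquiv.apply_symm_apply, LinearEquiv.apply_symm_apply]
  have hb : ∀ y : ι → F, Continuous fun u : ι → F => dotProductBilin F F u y := continuous_dotProductBilin_left
  have hρ := schrodingerSB_gram_eq T hT hl hb hbT (ψ := ψ)
  have hU1 := implementerUniqueUpToScalar_schrodingerSB_pi hl hb hψ
  -- pull `r` back to the standard model along `e⁻¹`
  have hpol' : ∀ v w : ((ι → F) × (ι → F)), polar (Matrix.toLinearMap₂' F T) (e.symm v) (e.symm w) = polar (dotProductBilin F F) v w :=
    form_symm_symm e hpol
  have hρ' : ∀ a : Heisenberg (polar (dotProductBilin F F (m := ι))),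
      schrodingerSB (dotProductBilin F F) ψ hl hb a =
        schrodingerSB (Matrix.toLinearMap₂' F T) ψ hl hbT (Heisenberg.mapEquiv e.symm hpol' a) := fun a => by
    rw [hρ]
    congr 1
    apply Heisenberg.ext
    · rw [Heisenberg.mapEquiv_v, Heisenberg.mapEquiv_v, LinearEquiv.apply_symm_apply]
    · rfl
  set r₁ := ImplementerSection.transport e.symm hpol' hρ' r with hr₁_def
  -- its cocycle is the Leray cocycle of `e ℓ`
  have hℓ₁ : LinearMap.BilinForm.orthogonal (alt (polar (dotProductBilin F F (m := ι)))) (ℓ.map (e : ((ι → F) × (ι → F)) →ₗ[F] ((ι → F) × (ι → F)))) = ℓ.map (e : ((ι → F) × (ι → F)) →ₗ[F] ((ι → F) × (ι → F))) :=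
    orthogonal_map_equiv_eq_self e hA hℓ
  have hback : (ℓ.map (e : ((ι → F) × (ι → F)) →ₗ[F] ((ι → F) × (ι → F)))).map (e.symm : ((ι → F) × (ι → F)) →ₗ[F] ((ι → F) × (ι → F))) = ℓ := by
    have e2 : (e.symm : ((ι → F) × (ι → F)) →ₗ[F] ((ι → F) × (ι → F))) ∘ₗ (e : ((ι → F) × (ι → F)) →ₗ[F] ((ι → F) × (ι → F))) = LinearMap.id := LinearMap.ext fun v => e.symm_apply_apply v
    rw [← Submodule.map_comp, e2, Submodule.map_id]
  have hr₁ : r₁.cocycle hU1 = lerayCentralCocycle μ hψ' (isAlt_alt_polar_dotProductBilin (F := F) (ι := ι))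
      nondegenerate_alt_polar_dotProductBilin hℓ₁ := by
    refine CentralCocycle.ext fun g₁ g₂ => Units.ext ?_
    rw [hr₁_def, ImplementerSection.cocycle_transport e.symm hpol' hρ' r hU1 hU, hr]
    change lerayCocycle (ψ.mulShift (⅟(2 : F))) μ (alt (polar (Matrix.toLinearMap₂' F T))) ℓ ((symplecticConj e.symm hpol' g₁ : (symplecticGroup (polar (Matrix.toLinearMap₂' F T)))) : ((ι → F) × (ι → F)) ≃ₗ[F] ((ι → F) × (ι → F)))
        ((symplecticConj e.symm hpol' g₂ : (symplecticGroup (polar (Matrix.toLinearMap₂' F T)))) : ((ι → F) × (ι → F)) ≃ₗ[F] ((ι → F) × (ι → F))) =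
      lerayCocycle (ψ.mulShift (⅟(2 : F))) μ (alt (polar (dotProductBilin F F (m := ι)))) (ℓ.map (e : ((ι → F) × (ι → F)) →ₗ[F] ((ι → F) × (ι → F)))) (g₁ : ((ι → F) × (ι → F)) ≃ₗ[F] ((ι → F) × (ι → F))) (g₂ : ((ι → F) × (ι → F)) ≃ₗ[F] ((ι → F) × (ι → F)))
    rw [coe_symplecticConj, coe_symplecticConj, ← lerayCocycle_conj μ e.symm hA' hψ' (ℓ.map (e : ((ι → F) × (ι → F)) →ₗ[F] ((ι → F) × (ι → F)))), hback]
  -- §3 for `r₁` at `Φ`, pulled back along `f ↦ e ∘ f ∘ e⁻¹`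
  obtain ⟨V₁, hV₁, hfix⟩ := exists_nhds_forall_parabolic_apply_eq_self_pi hl hb μ hψ hU1 r₁ hℓ₁ hr₁ Φ
  refine ⟨(fun f : ((ι → F) × (ι → F)) → ((ι → F) × (ι → F)) => (⇑(e : ((ι → F) × (ι → F)) →ₗ[F] ((ι → F) × (ι → F)))) ∘ f ∘ (⇑(e.symm : ((ι → F) × (ι → F)) →ₗ[F] ((ι → F) × (ι → F))))) ⁻¹' V₁,
    conj_preimage_mem_nhds_id _ _ (fun v => e.apply_symm_apply v) hV₁, fun g hg hgV => ?_⟩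
  -- `g₁ = e g e⁻¹ ∈ P_{eℓ}`, `⇑g₁ ∈ V₁`, `r g = r₁ g₁`
  set g₁ : (symplecticGroup (polar (dotProductBilin F F (m := ι)))) := (symplecticConj e.symm hpol').symm g with hg₁_def
  have hcoe : (⇑(g₁ : ((ι → F) × (ι → F)) ≃ₗ[F] ((ι → F) × (ι → F))) : ((ι → F) × (ι → F)) → ((ι → F) × (ι → F))) = (⇑(e : ((ι → F) × (ι → F)) →ₗ[F] ((ι → F) × (ι → F)))) ∘ (⇑(g : ((ι → F) × (ι → F)) ≃ₗ[F] ((ι → F) × (ι → F)))) ∘ (⇑(e.symm : ((ι → F) × (ι → F)) →ₗ[F] ((ι → F) × (ι → F)))) := by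
    funext v
    rw [hg₁_def, symplecticConj_symm_apply, LinearEquiv.symm_symm]
    rfl
  have hg₁ : Submodule.map ((g₁ : ((ι → F) × (ι → F)) ≃ₗ[F] ((ι → F) × (ι → F))) : ((ι → F) × (ι → F)) →ₗ[F] ((ι → F) × (ι → F))) (ℓ.map (e : ((ι → F) × (ι → F)) →ₗ[F] ((ι → F) × (ι → F)))) = ℓ.map (e : ((ι → F) × (ι → F)) →ₗ[F] ((ι → F) × (ι → F))) := by
    have e1 : ((g₁ : ((ι → F) × (ι → F)) ≃ₗ[F] ((ι → F) × (ι → F))) : ((ι → F) × (ι → F)) →ₗ[F] ((ι → F) × (ι → F))) =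
        (e : ((ι → F) × (ι → F)) →ₗ[F] ((ι → F) × (ι → F))) ∘ₗ ((g : ((ι → F) × (ι → F)) ≃ₗ[F] ((ι → F) × (ι → F))) : ((ι → F) × (ι → F)) →ₗ[F] ((ι → F) × (ι → F))) ∘ₗ (e.symm : ((ι → F) × (ι → F)) →ₗ[F] ((ι → F) × (ι → F))) :=
      LinearMap.ext fun v => congrFun hcoe v
    rw [e1, Submodule.map_comp, Submodule.map_comp, hback, hg]
  have hg₁V : (⇑(g₁ : ((ι → F) × (ι → F)) ≃ₗ[F] ((ι → F) × (ι → F))) : ((ι → F) × (ι → F)) → ((ι → F) × (ι → F))) ∈ V₁ := by rw [hcoe]; exact hgV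
  have hrg : r g = r₁ g₁ := by
    rw [hr₁_def, ImplementerSection.transport_apply, hg₁_def, MulEquiv.apply_symm_apply]
  rw [hrg]
  exact hfix g₁ hg₁ hg₁V

end Gram

end Literature.RepresentationTheory.HeisenbergGroup

end
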